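import Summits.CriticalPhenomena.PercolationContinuityZ3.Theorems.PercNearOneGluingAdditiveGluingKnThm2Designated
import Summits.CriticalPhenomena.PercolationContinuityZ3.Theorems.PercNearOneGluingAdditiveGluingDKernelInterp
import Summits.CriticalPhenomena.PercolationContinuityZ3.Theorems.PercNearOneGluingAdditiveGluingSigmaRecursion
import HarnessLib

/-! # Crux `PercNearOneGluing.AdditiveGluing` (stmt-CriticalPhenomena-4576) — the KN-Theorem-2 closure of the designated-pocket kernel
# for three relays, in the block (union) form consumed by `additiveGluing_of_dcone` (seat (d) round 4)

Support file (`--supports stmt-CriticalPhenomena-4576`); no definitions, no named facts.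

In the glued weighting `u/S` every non-loop pair inside `S` is sure, so almost surely the whole block is one cluster and the block events
`⋃_{v∈S} {v ↔ x}` coincide with the single-observer events `{s₀ ↔ x}`, `s₀ ∈ S` (`dthree_real_le_of_allOpen`: an inclusion that holds on
the conull set "all sure pairs open", `sigmaRec_conull`).  Hence the single-observer conclusion of `dKernel_three_of_knThm2` (Kozma–Nitzan's
Theorem 2 exchange at the designation `a₀`, relays `a₁, a₂`) gives the union-form kernel
  `μ_{u/S}((S ↔ A) ∩ (a₀ ↔ b)) ≤ μ_{u/S}(S ↔ b)`    for `A ⊆ {b, a₁, a₂, a₀}`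
(`dKernel_union_three_of_knThm2`): the 3-relay case of the D-line closes whenever `m₀ ≤ m₁₂` and the certificate
`A₁ P₂ (τ'₁ − τ'₀) + A₂ P₁ (τ'₂ − τ'₀) ≥ 0` holds (all in `u/S`, observer `s₀`).
[cite: KozmaNitzan2024, Theorem 2 (§3.2, pp. 8–9), §3.1 Remark p. 5 (gluing), Question 9 p. 36]
-/

namespace Summit.CriticalPhenomena.PercolationContinuityZ3.Theorems

open MeasureTheory Set
open Literature.Probability.LatticeModels (prodBernoulli)
open Literature.Probability.Percolation (BondConfig openConn openConnIn openGraph openCluster)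
open scoped BigOperators

noncomputable section
open Classical

section DKernelThree

open Literature.Probability.LatticeModels Literature.Probability.Percolation

variable {n : ℕ}

/-- In the glued weighting, an inclusion of events that holds whenever all non-loop pairs inside the block are open is an inequality of
probabilities (those pairs are sure: `sigmaRec_conull`). [folklore] -/
theorem dthree_real_le_of_allOpen (u : Sym2 (Fin n) → unitInterval) (S : Finset (Fin n)) (E F : Set (BondConfig (Fin n)))
    (h : ∀ ω : BondConfig (Fin n), (∀ v ∈ S, ∀ v' ∈ S, v ≠ v' → s(v, v') ∈ ω) → ω ∈ E → ω ∈ F) :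
    (prodBernoulli (fun e : Sym2 (Fin n) => if (∀ y ∈ e, y ∈ S) ∧ ¬ e.IsDiag then 1 else u e)).real E
      ≤ (prodBernoulli (fun e : Sym2 (Fin n) => if (∀ y ∈ e, y ∈ S) ∧ ¬ e.IsDiag then 1 else u e)).real F := by
  set g : Sym2 (Fin n) → unitInterval := fun e : Sym2 (Fin n) => if (∀ y ∈ e, y ∈ S) ∧ ¬ e.IsDiag then 1 else u e with hg
  set K : Set (BondConfig (Fin n)) := {ω | ∀ v ∈ S, ∀ v' ∈ S, v ≠ v' → s(v, v') ∈ ω} with hK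
  have hnull : prodBernoulli g Kᶜ = 0 := by
    refine sigmaRec_conull g K fun ω hω => ?_
    simp only [hK, Set.mem_setOf_eq, not_forall] at hω
    obtain ⟨v, hv, v', hv', hne, hvv⟩ := hω
    refine ⟨s(v, v'), ?_, hvv⟩
    rw [hg]
    simp only
    rw [if_pos]
    exact ⟨fun y hy => by rcases Sym2.mem_iff.1 hy with rfl | rfl <;> assumption, by rw [Sym2.mk_isDiag_iff]; exact hne⟩
  have hsub : E ⊆ F ∪ Kᶜ := by
    intro ω hω
    by_cases hωK : ω ∈ K
    · exact Or.inl (h ω hωK hω)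
    · exact Or.inr hωK
  have hKc : (prodBernoulli g).real Kᶜ = 0 := by
    rw [measureReal_def, hnull, ENNReal.toReal_zero]
  calc (prodBernoulli g).real E ≤ (prodBernoulli g).real (F ∪ Kᶜ) := measureReal_mono hsub (measure_ne_top _ _)
    _ ≤ (prodBernoulli g).real F + (prodBernoulli g).real Kᶜ := measureReal_union_le _ _
    _ = (prodBernoulli g).real F := by rw [hKc, add_zero]

/-- When all non-loop pairs inside `S` are open, every vertex of `S` is joined to `s₀ ∈ S`. [folklore] -/
theorem dthree_openConn_of_allOpen (S : Finset (Fin n)) (ω : BondConfig (Fin n))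
    (hK : ∀ v ∈ S, ∀ v' ∈ S, v ≠ v' → s(v, v') ∈ ω) {v s₀ : Fin n} (hv : v ∈ S) (hs₀ : s₀ ∈ S) :
    ω ∈ (openConn s₀ v : Set (BondConfig (Fin n))) := by
  by_cases hvs : s₀ = v
  · subst hvs
    exact (SimpleGraph.Reachable.refl s₀ : (openGraph ω).Reachable s₀ s₀)
  · exact (SimpleGraph.Adj.reachable ((openGraph_adj ω s₀ v).2 ⟨hK s₀ hs₀ v hv hvs, hvs⟩) : (openGraph ω).Reachable s₀ v)

/-- **The KN-Theorem-2 closure of the designated-pocket kernel for three relays, block form.**  For `A ⊆ {b, a₁, a₂, a₀}` (`b ∈ A`),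
`s₀ ∈ S`, in the glued weighting `u/S`: if `P₁, P₂, P₁₂ > 0`, `m₀ ≤ m₁₂` and the certificate `A₁ P₂ (τ'₁ − τ'₀) + A₂ P₁ (τ'₂ − τ'₀) ≥ 0`
holds, then `μ_{u/S}((S ↔ A) ∩ (a₀ ↔ b)) ≤ μ_{u/S}(S ↔ b)`.  [cite: KozmaNitzan2024, Theorem 2 (§3.2, pp. 8–9), Question 9 p. 36] -/
theorem dKernel_union_three_of_knThm2 (u : Sym2 (Fin n) → unitInterval) (A S : Finset (Fin n)) (s₀ b a₁ a₂ a₀ : Fin n)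
    (hs₀ : s₀ ∈ S) (hA : ∀ a ∈ A, a = b ∨ a = a₁ ∨ a = a₂ ∨ a = a₀)
    (h12 : a₁ ≠ a₂) (h10 : a₁ ≠ a₀) (h20 : a₂ ≠ a₀)
    (hP₁₂ : 0 < (prodBernoulli (fun e : Sym2 (Fin n) => if (∀ y ∈ e, y ∈ S) ∧ ¬ e.IsDiag then 1 else u e)).real
      ((openConn a₁ a₀)ᶜ ∩ (openConn a₂ a₀)ᶜ : Set (BondConfig (Fin n))))
    (hP₁ : 0 < (prodBernoulli (fun e : Sym2 (Fin n) => if (∀ y ∈ e, y ∈ S) ∧ ¬ e.IsDiag then 1 else u e)).real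
      ((openConn a₁ a₂)ᶜ ∩ (openConn a₁ a₀)ᶜ : Set (BondConfig (Fin n))))
    (hP₂ : 0 < (prodBernoulli (fun e : Sym2 (Fin n) => if (∀ y ∈ e, y ∈ S) ∧ ¬ e.IsDiag then 1 else u e)).real
      ((openConn a₂ a₁)ᶜ ∩ (openConn a₂ a₀)ᶜ : Set (BondConfig (Fin n))))
    (hcert : 0 ≤ (prodBernoulli (fun e : Sym2 (Fin n) => if (∀ y ∈ e, y ∈ S) ∧ ¬ e.IsDiag then 1 else u e)).real
            ((openConn a₁ a₂)ᶜ ∩ (openConn a₁ a₀)ᶜ ∩ openConn a₁ s₀)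
          * (prodBernoulli (fun e : Sym2 (Fin n) => if (∀ y ∈ e, y ∈ S) ∧ ¬ e.IsDiag then 1 else u e)).real
            ((openConn a₂ a₁)ᶜ ∩ (openConn a₂ a₀)ᶜ : Set (BondConfig (Fin n)))
          * ((prodBernoulli (fun e : Sym2 (Fin n) => if (∀ y ∈ e, y ∈ S) ∧ ¬ e.IsDiag then 1 else u e)).real (openConn a₁ b)
              - (prodBernoulli (fun e : Sym2 (Fin n) => if (∀ y ∈ e, y ∈ S) ∧ ¬ e.IsDiag then 1 else u e)).real (openConn a₀ b))
        + (prodBernoulli (fun e : Sym2 (Fin n) => if (∀ y ∈ e, y ∈ S) ∧ ¬ e.IsDiag then 1 else u e)).real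
            ((openConn a₂ a₁)ᶜ ∩ (openConn a₂ a₀)ᶜ ∩ openConn a₂ s₀)
          * (prodBernoulli (fun e : Sym2 (Fin n) => if (∀ y ∈ e, y ∈ S) ∧ ¬ e.IsDiag then 1 else u e)).real
            ((openConn a₁ a₂)ᶜ ∩ (openConn a₁ a₀)ᶜ : Set (BondConfig (Fin n)))
          * ((prodBernoulli (fun e : Sym2 (Fin n) => if (∀ y ∈ e, y ∈ S) ∧ ¬ e.IsDiag then 1 else u e)).real (openConn a₂ b)
              - (prodBernoulli (fun e : Sym2 (Fin n) => if (∀ y ∈ e, y ∈ S) ∧ ¬ e.IsDiag then 1 else u e)).real (openConn a₀ b)))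
    (hgood : (prodBernoulli (fun e : Sym2 (Fin n) => if (∀ y ∈ e, y ∈ S) ∧ ¬ e.IsDiag then 1 else u e)).real
        (openConn b a₀ ∩ (openConn b a₁)ᶜ ∩ (openConn b a₂)ᶜ) ≤
      (prodBernoulli (fun e : Sym2 (Fin n) => if (∀ y ∈ e, y ∈ S) ∧ ¬ e.IsDiag then 1 else u e)).real
        (openConn b a₁ ∩ openConn b a₂ ∩ (openConn b a₀)ᶜ)) :
    (prodBernoulli (fun e : Sym2 (Fin n) => if (∀ y ∈ e, y ∈ S) ∧ ¬ e.IsDiag then 1 else u e)).real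
        ((⋃ v ∈ S, ⋃ a ∈ A, openConn v a) ∩ openConn a₀ b)
      ≤ (prodBernoulli (fun e : Sym2 (Fin n) => if (∀ y ∈ e, y ∈ S) ∧ ¬ e.IsDiag then 1 else u e)).real
        (⋃ v ∈ S, openConn v b) := by
  have h3 := dKernel_three_of_knThm2 u S s₀ b a₁ a₂ a₀ h12 h10 h20 hP₁₂ hP₁ hP₂ hcert hgood
  -- union form ≤ single-observer form (a.s. under the glued weighting)
  have hL : (prodBernoulli (fun e : Sym2 (Fin n) => if (∀ y ∈ e, y ∈ S) ∧ ¬ e.IsDiag then 1 else u e)).real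
        ((⋃ v ∈ S, ⋃ a ∈ A, openConn v a) ∩ openConn a₀ b)
      ≤ (prodBernoulli (fun e : Sym2 (Fin n) => if (∀ y ∈ e, y ∈ S) ∧ ¬ e.IsDiag then 1 else u e)).real
        ((openConn s₀ a₁ ∪ openConn s₀ a₂ ∪ openConn s₀ a₀) ∩ openConn a₀ b) := by
    refine dthree_real_le_of_allOpen u S _ _ fun ω hK hω => ?_
    obtain ⟨hU, hab⟩ := hω
    refine ⟨?_, hab⟩
    simp only [Set.mem_iUnion] at hU
    obtain ⟨v, hv, a, ha, hva⟩ := hU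
    have hsv : ω ∈ (openConn s₀ v : Set (BondConfig (Fin n))) := dthree_openConn_of_allOpen S ω hK hv hs₀
    have hsa : ω ∈ (openConn s₀ a : Set (BondConfig (Fin n))) := blockGrowth_openConn_trans hsv hva
    rcases hA a ha with rfl | rfl | rfl | rfl
    · -- `a = b`: then `s₀ ↔ b ↔ a₀`
      exact Or.inr (blockGrowth_openConn_trans hsa (blockGrowth_openConn_symm hab))
    · exact Or.inl (Or.inl hsa)
    · exact Or.inl (Or.inr hsa)
    · exact Or.inr hsa
  have hR : (prodBernoulli (fun e : Sym2 (Fin n) => if (∀ y ∈ e, y ∈ S) ∧ ¬ e.IsDiag then 1 else u e)).real (openConn s₀ b)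
      ≤ (prodBernoulli (fun e : Sym2 (Fin n) => if (∀ y ∈ e, y ∈ S) ∧ ¬ e.IsDiag then 1 else u e)).real (⋃ v ∈ S, openConn v b) :=
    measureReal_mono (fun ω hω => Set.mem_iUnion₂.2 ⟨s₀, hs₀, hω⟩) (measure_ne_top _ _)
  linarith

end DKernelThree

end

end Summit.CriticalPhenomena.PercolationContinuityZ3.Theorems
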